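import Summits.HodgeConjecture.HodgeConjecture.Theses.CurveNetMordellWeil
import Literature.AlgebraicGeometry.HodgeTheory.HodgeClassesCupPairing
import Literature.AlgebraicGeometry.HodgeTheory.ComplexGysinHodgeType
import Literature.AlgebraicGeometry.HodgeTheory.ComplexGysinRational
import Literature.AlgebraicGeometry.HodgeTheory.RationalClassesRingChange
import Literature.AlgebraicGeometry.HodgeTheory.RationalClassesIndependent
import Literature.AlgebraicGeometry.HodgeTheory.HodgeFiltrationModelsReductionProofs
import Literature.AlgebraicGeometry.HodgeTheory.ComplexConjugationHolds
import Literature.AlgebraicGeometry.HodgeTheory.HodgeTypePullback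
import Literature.AlgebraicGeometry.HodgeTheory.HodgeTypeConjugation
import Literature.AlgebraicGeometry.HodgeTheory.GysinKernel
import Literature.AlgebraicGeometry.HodgeTheory.GysinKernelProofs
import Literature.AlgebraicGeometry.HodgeTheory.GysinHodgeClassLiftProofs
import Literature.AlgebraicGeometry.HodgeTheory.GysinBaseChangeOfKunneth
import Literature.AlgebraicGeometry.HodgeTheory.CrossProductTopClass
import Literature.AlgebraicGeometry.HodgeTheory.HardLefschetzThreefold
import Literature.AlgebraicTopology.SingularHomology.GysinMapSupportProofs
import Literature.Barriers.HodgeConjecture.GeneralizedHodgeTrivialReasonsParity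
import Literature.NumberTheory.Transcendental.DeRhamTheoremMultiplicative

/-!
# Route CurveNetMordellWeil · crux `VerticalSupportFourfolds` (stmt-HodgeConjecture-2784) — line `Sketch`,
# stub `stub_detectionTransfer` (the transfer C⁺ ⇒ crux)

Registered stub of the lead's skeleton `Cruxes/VerticalSupportFourfolds/Lines/Sketch.lean`. Granted
(as hypotheses, the two other inputs of the skeleton):

* `hPair` — BFNP (6.1) on smooth projective threefolds in the slice `(k, l) = (2, 1)`: a non-zero
  rational `(2,2)`-class `c ∈ H⁴(W(ℂ); ℂ)` has a rational `(1,1)` partner `a` with `c ∪ a ≠ 0`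
  (the `(3, W)` instance of the named fact `hodgeClasses_cupPairing_nondegenerate`);
* `hTop` — top-degree injectivity of the Gysin morphisms `complexGysin μ` (proved in the tree:
  `Theorems.stub_topGysinInjective`);
* `hDet` — VERTICAL DETECTION (C⁺ of the line card `vertical-detection-contact-locus`): on a smooth
  projective fourfold `X` with a surjection `pr : X ⟶ ℙ³`, a rational `(2,2)`-class which pulls back
  to `0` along every vertical smooth projective threefold `g : W ⟶ X` (`pr ∘ g` lands in a proper
  Zariski-closed `T ⊊ ℙ³`) is zero,

we prove: for every smooth projective fourfold `X` and every surjective `pr : X ⟶ ℙ³`, the span of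
the rational `(2,2)`-classes of `X` lies in the span of the VERTICAL rational `(2,2)`-classes (those
dying off `pr⁻¹(T)` for some Zariski-closed `T ⊊ ℙ³`) — which contains the crux
`VerticalSupportFourfolds` (whose right-hand side is `algebraicClasses X 2 ⊔` that span).

## Proof

Linear algebra (`ratComb_mem_of_detection`): let `b` be a finite `ℚ`-basis of the rational classes
of `H⁴(X(ℂ); ℂ)` (`smoothProjective_rationalClasses_finiteRatBasis_holds`), `P` the `ℂ`-subspace of
`(2,2)`-classes (read in one Hodge model, `hodgePQ_independent_of_hodgeModel_holds`), `S` the span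
of the vertical rational `(2,2)`-classes, `R' = {q ∈ ℚʳ | Σ qⱼ bⱼ ∈ P}` and
`A' = {q ∈ R' | Σ qⱼ bⱼ ∈ S}`. The cup form `B = ∪ : H⁴ × H⁴ → H⁸` takes, on rational classes,
values in `ℚ · ω` for one top class `ω` (`H⁸(X(ℂ); ℂ)` is a line and `Hᵏ(–; ℚ) ⊗ ℂ ↪ Hᵏ(–; ℂ)`),
so `q ↦ (a ↦ coefficient of B(Σ qⱼ bⱼ, Σ aⱼ bⱼ))` is a `ℚ`-linear map `R' → (A')^∨`; if
`A' ≠ R'` its kernel is non-zero (`dim (A')^∨ = dim A' < dim R'`), i.e. there is a non-zero rational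
`(2,2)`-class `c` with `c ∪ a = 0` for every vertical rational `(2,2)`-class `a`.

Geometry (`hdet`): such a `c` is zero — contradiction. Indeed for a vertical `g : W ⟶ X` and a
rational `(1,1)`-class `D` on `W`, `g_* D` is, up to one non-zero scalar `u`, a rational class
(`complexGysin_ringChange_eq_smul_gysinMap`), of type `(2,2)` (`isOfHodgeType_complexGysin`), and it
dies off `pr⁻¹(T) ⊇ g(W)` (`restrictCompl_complexGysin_eq_zero`): so `u • g_* D ∈ A'` and
`c ∪ g_* D = 0`. By the projection formula `g_*(g^* c ∪ D) = c ∪ g_* D = 0` (`complexGysin_cup`), by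
`hTop` `g^* c ∪ D = 0`; as `g^* c` is rational of type `(2,2)` on `W`, `hPair` forces `g^* c = 0`;
and `hDet` gives `c = 0`.
-/

noncomputable section

-- mandated namespace `Summit.HodgeConjecture.HodgeConjecture.Theorems` (single-problem summit) trips
-- `linter.dupNamespace`; off tree-wide in the lakefile, restated for stand-alone elaboration.
set_option linter.dupNamespace false

open CategoryTheory
open scoped Manifold
open Literature.AlgebraicGeometry Literature.AlgebraicGeometry.Motives
  Literature.AlgebraicGeometry.HodgeTheory Literature.AlgebraicTopology.SingularHomology
open Literature.Barriers.HodgeConjecture (ratComb ratComb_add ratComb_smul ratComb_zero IsRatBasisOn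
  smoothProjective_rationalClasses_finiteRatBasis_holds)

namespace Summit.HodgeConjecture.HodgeConjecture.Theorems

/-! ### Linear algebra: rational detection in a `ℂ`-vector space with a finite `ℚ`-basis -/

section LinearAlgebra

variable {H L : Type*} [AddCommGroup H] [Module ℂ H] [AddCommGroup L] [Module ℂ L]

/-- **Detection implies membership** (the dimension count of BFNP §6, abstract form). Let `b` be a
`ℚ`-linearly independent finite family in a `ℂ`-vector space `H`, `P`, `S` two `ℂ`-subspaces, `B` a
`ℂ`-bilinear form on `H` with values in `L` whose values on the rational combinations of `b` are
rational multiples of one vector `ω`. If every rational combination `c` of `b` lying in `P` and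
`B`-orthogonal to all rational combinations lying in `P ∩ S` vanishes, then every rational
combination lying in `P` lies in `S`: otherwise the `ℚ`-linear map `R' → (A')^∨` given by the
coefficients of `B` (`R'`, `A'` the coefficient spaces of `P`, `P ∩ S`) has a non-zero kernel by
`dim (A')^∨ = dim A' < dim R'`. [cite: BrosnanFangNiePearlstein2009, §6 (6.1) and Lemma 48] -/
theorem ratComb_mem_of_detection {r : ℕ} (b : Fin r → H)
    (hinj : ∀ q : Fin r → ℚ, ratComb b q = 0 → q = 0) (P S : Submodule ℂ H)
    (B : H →ₗ[ℂ] H →ₗ[ℂ] L) (ω : L)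
    (hval : ∀ q q' : Fin r → ℚ, ∃ t : ℚ, B (ratComb b q) (ratComb b q') = ((t : ℚ) : ℂ) • ω)
    (hdet : ∀ q : Fin r → ℚ, ratComb b q ∈ P →
      (∀ q' : Fin r → ℚ, ratComb b q' ∈ P → ratComb b q' ∈ S →
        B (ratComb b q) (ratComb b q') = 0) → ratComb b q = 0) :
    ∀ q : Fin r → ℚ, ratComb b q ∈ P → ratComb b q ∈ S := by
  classical
  -- the coefficient spaces of `P` and of `P ∩ S`
  let R' : Submodule ℚ (Fin r → ℚ) :=
    { carrier := {q | ratComb b q ∈ P}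
      add_mem' := fun {q q'} hq hq' ↦ by
        simp only [Set.mem_setOf_eq, ratComb_add]
        exact P.add_mem hq hq'
      zero_mem' := by simp only [Set.mem_setOf_eq, ratComb_zero]; exact P.zero_mem
      smul_mem' := fun t q hq ↦ by
        simp only [Set.mem_setOf_eq, ratComb_smul]
        exact P.smul_mem _ hq }
  let A' : Submodule ℚ (Fin r → ℚ) :=
    { carrier := {q | ratComb b q ∈ P ∧ ratComb b q ∈ S}
      add_mem' := fun {q q'} hq hq' ↦ by
        simp only [Set.mem_setOf_eq, ratComb_add]
        exact ⟨P.add_mem hq.1 hq'.1, S.add_mem hq.2 hq'.2⟩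
      zero_mem' := by
        simp only [Set.mem_setOf_eq, ratComb_zero]
        exact ⟨P.zero_mem, S.zero_mem⟩
      smul_mem' := fun t q hq ↦ by
        simp only [Set.mem_setOf_eq, ratComb_smul]
        exact ⟨P.smul_mem _ hq.1, S.smul_mem _ hq.2⟩ }
  have hA'R' : A' ≤ R' := fun q hq ↦ hq.1
  intro q₀ hq₀
  by_contra hnot
  choose t ht using hval
  -- degenerate case: all values vanish
  by_cases hω : ω = 0
  · have h0 : ratComb b q₀ = 0 :=
      hdet q₀ hq₀ fun q' _ _ ↦ by rw [ht, hω, smul_zero]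
    exact hnot (h0 ▸ S.zero_mem)
  -- the coefficient `t` is uniquely determined and `ℚ`-bilinear
  have huniq : ∀ {x y : ℚ}, ((x : ℚ) : ℂ) • ω = ((y : ℚ) : ℂ) • ω → x = y := fun h ↦ by
    exact_mod_cast smul_left_injective ℂ hω h
  have ht_add_left : ∀ q₁ q₂ q', t (q₁ + q₂) q' = t q₁ q' + t q₂ q' := by
    intro q₁ q₂ q'
    apply huniq
    rw [← ht, ratComb_add, map_add, LinearMap.add_apply, ht, ht, Rat.cast_add, add_smul]
  have ht_smul_left : ∀ (a : ℚ) q q', t (a • q) q' = a * t q q' := by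
    intro a q q'
    apply huniq
    rw [← ht, ratComb_smul, map_smul, LinearMap.smul_apply, ht, smul_smul, Rat.cast_mul]
  have ht_add_right : ∀ q q₁ q₂, t q (q₁ + q₂) = t q q₁ + t q q₂ := by
    intro q q₁ q₂
    apply huniq
    rw [← ht, ratComb_add, map_add, ht, ht, Rat.cast_add, add_smul]
  have ht_smul_right : ∀ (a : ℚ) q q', t q (a • q') = a * t q q' := by
    intro a q q'
    apply huniq
    rw [← ht, ratComb_smul, map_smul, ht, smul_smul, Rat.cast_mul]
  -- the `ℚ`-linear map `R' → (A')^∨`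
  let Φ : R' →ₗ[ℚ] Module.Dual ℚ A' :=
    { toFun := fun q ↦
        { toFun := fun a ↦ t q.1 a.1
          map_add' := fun a₁ a₂ ↦ ht_add_right q.1 a₁.1 a₂.1
          map_smul' := fun s a ↦ by
            rw [RingHom.id_apply, smul_eq_mul]
            exact ht_smul_right s q.1 a.1 }
      map_add' := fun q₁ q₂ ↦ by
        ext a
        exact ht_add_left q₁.1 q₂.1 a.1
      map_smul' := fun s q ↦ by
        ext a
        rw [RingHom.id_apply, LinearMap.smul_apply, smul_eq_mul]
        exact ht_smul_left s q.1 a.1 }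
  -- dimension count: `dim A' < dim R'`, so `ker Φ ≠ 0`
  have hlt' : A' < R' := by
    refine lt_of_le_of_ne hA'R' fun hEq ↦ hnot ?_
    have hmem : q₀ ∈ A' := hEq ▸ (hq₀ : q₀ ∈ R')
    exact hmem.2
  have hlt : Module.finrank ℚ A' < Module.finrank ℚ R' := Submodule.finrank_lt_finrank_of_lt hlt'
  have hker : LinearMap.ker Φ ≠ ⊥ := by
    intro hbot
    have h1 := LinearMap.finrank_range_add_finrank_ker Φ
    rw [hbot, finrank_bot, add_zero] at h1
    have h2 : Module.finrank ℚ (LinearMap.range Φ) ≤ Module.finrank ℚ (Module.Dual ℚ A') :=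
      Submodule.finrank_le _
    rw [Subspace.dual_finrank_eq] at h2
    omega
  obtain ⟨q, hqker, hqne⟩ := (Submodule.ne_bot_iff _).1 hker
  -- a non-zero kernel vector is a rational combination in `P` orthogonal to `P ∩ S`, hence zero
  have hzero : ratComb b q.1 = 0 := by
    refine hdet q.1 q.2 fun q' hP hS ↦ ?_
    have hΦ : Φ q ⟨q', hP, hS⟩ = 0 := by
      rw [LinearMap.mem_ker.1 hqker, LinearMap.zero_apply]
    have htq : t q.1 q' = 0 := hΦ
    rw [ht, htq, Rat.cast_zero, zero_smul]
  exact hqne (Subtype.ext (hinj _ hzero))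

/-- **A rational multiple of a rational generator of a complex line is a RATIONAL multiple**: if
`w ≠ 0` and `v` are rational classes of `H⁸ := H²ⁿ(X(ℂ); ℂ)` and `v = s • w`, then `s ∈ ℚ` — rational
classes satisfying no rational relation are `ℂ`-linearly independent
(`linearIndependent_of_isRationalClass`, the injectivity of `Hᵏ(–; ℚ) ⊗ ℂ → Hᵏ(–; ℂ)`).
[cite: VoisinHodgeI2002, §7.1.1] [cite: HatcherAT2002, §3.1 Thm. 3.2] -/
theorem exists_ratCast_eq_of_isRationalClass_smul {Y : Type} [TopologicalSpace Y] {k : ℕ}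
    {w v : singularCohomology ℂ ℂ Y k} (hw : IsRationalClass w) (hv : IsRationalClass v)
    (hw0 : w ≠ 0) {s : ℂ} (hs : v = s • w) : ∃ t : ℚ, v = ((t : ℚ) : ℂ) • w := by
  classical
  -- the pair `(w, v)` is `ℂ`-linearly dependent, hence satisfies a non-trivial rational relation
  by_contra hcon
  push Not at hcon
  have hind : LinearIndependent ℂ ![w, v] := by
    refine linearIndependent_of_isRationalClass (fun j ↦ ?_) fun q hq ↦ ?_
    · fin_cases j
      · exact hw
      · exact hv
    · rw [Fin.sum_univ_two] at hq
      simp only [Matrix.cons_val_zero, Matrix.cons_val_one] at hq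
      by_cases h1 : q 1 = 0
      · rw [h1, Rat.cast_zero, zero_smul, add_zero] at hq
        have h0 : q 0 = 0 := by
          by_contra h0
          exact hw0 ((smul_eq_zero.1 hq).resolve_left (by exact_mod_cast h0))
        funext j
        fin_cases j
        · exact h0
        · exact h1
      · exfalso
        refine hcon (-(q 0 / q 1)) ?_
        have h1' : ((q 1 : ℚ) : ℂ) ≠ 0 := by exact_mod_cast h1
        have hv' : v = -((((q 0 : ℚ) : ℂ)) / ((q 1 : ℚ) : ℂ)) • w := by
          have : ((q 1 : ℚ) : ℂ) • v = -(((q 0 : ℚ) : ℂ) • w) := eq_neg_of_add_eq_zero_right hq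
          calc v = (((q 1 : ℚ) : ℂ))⁻¹ • (((q 1 : ℚ) : ℂ) • v) := by
                rw [smul_smul, inv_mul_cancel₀ h1', one_smul]
            _ = -((((q 0 : ℚ) : ℂ)) / ((q 1 : ℚ) : ℂ)) • w := by
                rw [this, smul_neg, smul_smul, neg_smul, div_eq_inv_mul]
        rw [hv']
        congr 1
        push_cast
        ring
  have hdep : ¬ LinearIndependent ℂ ![w, v] := by
    rw [LinearIndependent.pair_iff]
    intro h
    have := h s (-1) (by rw [hs]; simp)
    exact one_ne_zero (neg_eq_zero.1 this.2)
  exact hdep hind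

end LinearAlgebra

/-! ### The transfer -/

/-- **Gysin images of rational classes are rational up to one non-zero scalar** (for an arbitrary
`ℂ`-orientation family `μ` with Poincaré duality): `f_*(ι y) = u • ι(f_! y)` with the rational
Gysin homomorphism `f_!` of `ℚ`-orientations (`complexGysin_ringChange_eq_smul_gysinMap`).
[cite: FultonYoungTableaux1997, Appendix B §B.1 (5)] [cite: VoisinHodgeI2002, §7.3.2] -/
theorem exists_smul_complexGysin_isRationalClass_of_hasPoincareDuality {μ : OrientationFamily}
    (hμ : μ.HasPoincareDuality) {d n : ℕ} {Y X : SchemeOver ℂ} (hY : IsSmoothProjective d Y)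
    (hX : IsSmoothProjective n X) (f : Y ⟶ X) {a b q : ℕ} (ha : a + q = 2 * d)
    (hb : b + q = 2 * n) (hab : a + 2 * n = b + 2 * d) :
    ∃ u : ℂ, u ≠ 0 ∧ ∀ y : complexBetti Y a, IsRationalClass y →
      IsRationalClass (u • complexGysin μ hY hX f hab y) := by
  obtain ⟨νY, -⟩ := exists_ratOrientation_hasPoincareDuality hY
  obtain ⟨νX, hνX⟩ := exists_ratOrientation_hasPoincareDuality hX
  obtain ⟨u, hu, hcomp⟩ := complexGysin_ringChange_eq_smul_gysinMap hμ hY hX f ha hb νY νX hνX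
  refine ⟨u⁻¹, inv_ne_zero hu, fun y hy ↦ ?_⟩
  obtain ⟨x, rfl⟩ := hy.exists_ringChange_eq
  rw [hcomp x, smul_smul, inv_mul_cancel₀ hu, one_smul]
  exact isRationalClass_ringChange _

/-- **Registered stub `stub_detectionTransfer`** (crux stmt-HodgeConjecture-2784
`CurveNetMordellWeil.VerticalSupportFourfolds`, line `Sketch`): the threefold pairing `hPair`
(BFNP (6.1), slice `(3, 2, 1)`), the top-degree injectivity of Gysin morphisms `hTop` and VERTICAL
DETECTION `hDet` imply that on every smooth projective fourfold `X` with a surjection `pr : X ⟶ ℙ³`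
the span of the rational `(2,2)`-classes lies in the span of the vertical rational `(2,2)`-classes
(those dying off `pr⁻¹(T)`, `T ⊊ ℙ³` Zariski-closed). Proof in the module docstring: dimension count
for the rational cup form (`ratComb_mem_of_detection`) + projection formula (`complexGysin_cup`) +
support, rationality and Hodge type of Gysin images.
[cite: BrosnanFangNiePearlstein2009, §6 (6.1)] [cite: FultonYoungTableaux1997, Appendix B §B.1 (5)–(6)]
[cite: VoisinHodgeI2002, §7.3.2] -/
theorem stub_detectionTransfer :
    (∀ ⦃W : Motives.SchemeOver ℂ⦄, Motives.IsSmoothProjective 3 W →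
      ∀ (m : ℕ) (hm : 2 * 2 + 2 * 1 = m) (c : complexBetti W (2 * 2)), IsRationalClass c →
        IsOfHodgeType 3 W (2 * 2) 2 2 c → c ≠ 0 →
          ∃ a : complexBetti W (2 * 1), IsRationalClass a ∧ IsOfHodgeType 3 W (2 * 1) 1 1 a ∧
            cupProduct hm c a ≠ 0) →
    (∀ (μ : OrientationFamily), μ.HasPoincareDuality →
      ∀ ⦃m n : ℕ⦄ ⦃W X : Motives.SchemeOver ℂ⦄ (hW : Motives.IsSmoothProjective m W)
        (hX : Motives.IsSmoothProjective n X) (g : W ⟶ X) ⦃a b : ℕ⦄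
        (hab : a + 2 * n = b + 2 * m), a = 2 * m →
          Function.Injective (complexGysin μ hW hX g hab)) →
    (∀ ⦃X : Motives.SchemeOver ℂ⦄ (pr : X ⟶ Motives.projectiveSpace 3 ℂ),
      Motives.IsSmoothProjective 4 X → Function.Surjective pr.left.base →
        ∀ c : complexBetti X (2 * 2), IsRationalClass c → IsOfHodgeType 4 X (2 * 2) 2 2 c →
          (∀ ⦃W : Motives.SchemeOver ℂ⦄, Motives.IsSmoothProjective 3 W → ∀ g : W ⟶ X,
              (∃ T : Set (Motives.projectiveSpace 3 ℂ).left, IsClosed T ∧ T ≠ Set.univ ∧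
                  Set.range (g ≫ pr).left.base ⊆ T) →
                complexBetti.map g (2 * 2) c = 0) →
            c = 0) →
    ∀ ⦃X : Motives.SchemeOver ℂ⦄ (pr : X ⟶ Motives.projectiveSpace 3 ℂ),
      Motives.IsSmoothProjective 4 X → Function.Surjective pr.left.base →
        Submodule.span ℂ {c : complexBetti X (2 * 2) |
            IsRationalClass c ∧ IsOfHodgeType 4 X (2 * 2) 2 2 c} ≤
          Submodule.span ℂ {c : complexBetti X (2 * 2) |
            IsRationalClass c ∧ IsOfHodgeType 4 X (2 * 2) 2 2 c ∧
              ∃ T : Set (Motives.projectiveSpace 3 ℂ).left, IsClosed T ∧ T ≠ Set.univ ∧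
                complexBetti.restrictCompl X (pr.left.base ⁻¹' T) (2 * 2) c = 0} := by
  intro hPair hTop hDet X pr hX hsurj
  -- notation for the vertical rational `(2,2)`-classes and their span
  set S := Submodule.span ℂ {c : complexBetti X (2 * 2) |
      IsRationalClass c ∧ IsOfHodgeType 4 X (2 * 2) 2 2 c ∧
        ∃ T : Set (Motives.projectiveSpace 3 ℂ).left, IsClosed T ∧ T ≠ Set.univ ∧
          complexBetti.restrictCompl X (pr.left.base ⁻¹' T) (2 * 2) c = 0} with hSdef
  refine Submodule.span_le.2 ?_
  rintro c₀ ⟨hc₀, hH₀⟩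
  -- degree bookkeeping
  have h213 : 2 * 2 + 2 * 1 = 2 * 3 := by norm_num
  have h448 : 2 * 2 + 2 * 2 = 2 * 4 := by norm_num
  have h68 : 2 * 3 + 2 * 4 = 2 * 4 + 2 * 3 := by norm_num
  have hq24 : 2 * 1 + 2 * 4 = 2 * 2 + 2 * 3 := by norm_num
  -- Hodge-theoretic inputs, all proved in the tree
  have hI : hodgePQ_independent_of_hodgeModel := hodgePQ_independent_of_hodgeModel_holds
  have hM : ∀ (m : ℕ) (Y : Motives.SchemeOver ℂ), nonempty_hodgeModel m Y :=
    fun _ _ ↦ nonempty_hodgeModel_holds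
  have hdR : ∀ (E : Type) [NormedAddCommGroup E] [NormedSpace ℂ E] [FiniteDimensional ℂ E],
      Literature.NumberTheory.Transcendental.exists_deRhamIsoFamily 𝓘(ℝ, E) :=
    fun E _ _ _ ↦ Literature.NumberTheory.Transcendental.exists_deRhamIsoFamily_holds E
  obtain ⟨A⟩ := (hM 4 X).nonempty hX
  -- an orientation family with Poincaré duality; the support property of Gysin maps
  let μ : OrientationFamily := fun n Y hY ↦ (Motives.ComplexPoints.isOrientableOver ℂ hY).some
  have hμ : μ.HasPoincareDuality := OrientationFamily.hasPoincareDuality μ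
  have hSupp := gysinMap_restrictCompl_eq_zero_of_field.{0, 0} ℂ
  -- the `ℂ`-subspace of `(2,2)`-classes, read in the model `A`
  let P : Submodule ℂ (complexBetti X (2 * 2)) :=
    (A.hodgePQ (2 * 2) 2 2).comap (A.pullback (2 * 2)).hom
  have mem_P : ∀ {x : complexBetti X (2 * 2)}, x ∈ P ↔ IsOfHodgeType 4 X (2 * 2) 2 2 x := by
    intro x
    rw [hI.isOfHodgeType_iff hX A]
    rfl
  -- a finite `ℚ`-basis of the rational classes of `H⁴(X(ℂ); ℂ)`
  obtain ⟨r, b, hb⟩ := smoothProjective_rationalClasses_finiteRatBasis_holds 4 X hX (2 * 2)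
  have hinj : ∀ q : Fin r → ℚ, ratComb b q = 0 → q = 0 := by
    intro q hq
    obtain ⟨q₁, -, huq⟩ := hb.2 0 IsRationalClass.zero
    rw [huq q hq, huq 0 (ratComb_zero b)]
  -- a non-zero rational top class `ω`; rational top classes are its RATIONAL multiples
  obtain ⟨ω, hω0, hωrat⟩ := exists_isRationalClass_top_ne_zero μ hX
  have hval : ∀ q q' : Fin r → ℚ, ∃ t : ℚ,
      cupProduct h448 (ratComb b q) (ratComb b q') = ((t : ℚ) : ℂ) • ω := by
    intro q q'
    have hrat : IsRationalClass (cupProduct h448 (ratComb b q) (ratComb b q')) :=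
      IsRationalClass.cup h448 (hb.1 q) (hb.1 q')
    obtain ⟨s, hs⟩ := exists_eq_smul_of_top μ hX hω0 (cupProduct h448 (ratComb b q) (ratComb b q'))
    exact exists_ratCast_eq_of_isRationalClass_smul hωrat hrat hω0 hs
  -- every rational `(2,2)`-class is `ratComb b q` for some `q` with `ratComb b q ∈ P`
  obtain ⟨q₀, hq₀, -⟩ := hb.2 c₀ hc₀
  rw [← hq₀]
  refine ratComb_mem_of_detection b hinj P S (cupProduct h448) ω hval ?_ q₀
    (mem_P.2 (hq₀ ▸ hH₀))
  -- the geometric heart: a rational `(2,2)`-class orthogonal to the vertical ones is zero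
  intro q hqP horth
  have hc : IsRationalClass (ratComb b q) := hb.1 q
  have hH : IsOfHodgeType 4 X (2 * 2) 2 2 (ratComb b q) := mem_P.1 hqP
  refine hDet pr hX hsurj _ hc hH fun W hW g hvert ↦ ?_
  obtain ⟨T, hT, hTne, hrange⟩ := hvert
  by_contra hne
  -- `g^* c` is a non-zero rational `(2,2)`-class on the threefold `W`: pair it with a divisor class
  obtain ⟨Bw⟩ := (hM 3 W).nonempty hW
  have hgc : IsRationalClass (complexBetti.map g (2 * 2) (ratComb b q)) :=
    hc.pullback (Motives.AlgPoints.mapContinuous (L := ℂ) g)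
  have hgcH : IsOfHodgeType 3 W (2 * 2) 2 2 (complexBetti.map g (2 * 2) (ratComb b q)) :=
    hH.map_of_independent hI hW hX Bw g
  obtain ⟨D, hD, hDH, hcup⟩ := hPair hW (2 * 3) h213 _ hgc hgcH hne
  -- `y = g_* D`, rational up to the scalar `u ≠ 0`, of type `(2,2)`, dying off `pr⁻¹(T)`
  set y := complexGysin μ hW hX g hq24 D with hydef
  obtain ⟨u, hu, hurat⟩ := exists_smul_complexGysin_isRationalClass_of_hasPoincareDuality hμ hW hX g
    (a := 2 * 1) (b := 2 * 2) (q := 2 * 2) (by norm_num) (by norm_num) hq24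
  have hy_rat : IsRationalClass (u • y) := hurat D hD
  have hy_H : IsOfHodgeType 4 X (2 * 2) 2 2 (u • y) :=
    (isOfHodgeType_complexGysin hI hM hdR μ hW hX g hq24 (p := 1) (q := 1) (p' := 2) (q' := 2)
      (by norm_num) (by norm_num) hDH).smul u
  have hgT : Set.range g.left.base ⊆ pr.left.base ⁻¹' T := by
    rintro _ ⟨w', rfl⟩
    exact hrange ⟨w', rfl⟩
  have hy_vert : complexBetti.restrictCompl X (pr.left.base ⁻¹' T) (2 * 2) (u • y) = 0 := by
    rw [map_smul, hydef, restrictCompl_complexGysin_eq_zero hSupp μ hμ hX hW g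
      (hT.preimage pr.left.base.hom.continuous) hgT hq24 D, smul_zero]
  have hyS : u • y ∈ S := Submodule.subset_span ⟨hy_rat, hy_H, T, hT, hTne, hy_vert⟩
  obtain ⟨q', hq', -⟩ := hb.2 (u • y) hy_rat
  -- orthogonality: `c ∪ (u • y) = 0`, so `c ∪ y = 0`
  have h0 : cupProduct h448 (ratComb b q) (u • y) = 0 := by
    rw [← hq']
    exact horth q' (mem_P.2 (hq' ▸ hy_H)) (hq' ▸ hyS)
  have h1 : cupProduct h448 (ratComb b q) y = 0 := by
    rw [map_smul] at h0
    exact (smul_eq_zero.1 h0).resolve_left hu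
  -- projection formula `g_*(g^* c ∪ D) = c ∪ g_* D = 0` and top-degree injectivity
  have h2 := complexGysin_cup hμ hW hX g h213 h68 hq24 h448 (ratComb b q) D
  rw [← hydef, h1] at h2
  have h3 : cupProduct h213 (complexBetti.map g (2 * 2) (ratComb b q)) D = 0 :=
    hTop μ hμ hW hX g h68 rfl (by rw [h2, map_zero])
  exact hcup h3

end Summit.HodgeConjecture.HodgeConjecture.Theorems

end
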